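import Mathlib
import Summits.QuantumFields.YangMills.Theorems.PencilRigidityShellRigidityPlanarDiscSections
import Summits.QuantumFields.YangMills.Theorems.PencilRigidityShellRigidityConeOfDiscSections
import Summits.QuantumFields.YangMills.Theorems.PencilRigidityShellRigidityPlanarAngularRigidity
import HarnessLib

/-!
# The planar engine: a planar kernel represented in both charts is radial
(stub `stub_planarRadial`, crux `PencilRigidity.ShellRigidity`)

Line `transverse-smearing-planar-threshold` of crux `PencilRigidity.ShellRigidity`
(stmt-QuantumFields-11685).

Informal statement. Let `F : ℝ² → ℝ` be continuous off the origin, of order `0 < σ < 8`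
(`|F x| ≤ C (1 + |x|^{-σ})`), and `D₄`-symmetric (`F(t,s) = F(s,t) = F(t,-s) = F(-t,s)`). Suppose
that for every shift `ε > 0` there are finite measures on `ℝ⁴` carried by `{p₀ ≥ 0}` representing
the axis restriction, `F(ε + t, b) = ∫ e^{-t p₀ + i b p₁} dμ_ε` (`t ≥ 0`), and the diagonal
restriction, `F((ε+u+v)/√2, (ε+u-v)/√2) = ∫ e^{-u p₀ + i v p₁} dμ^D_ε` (`u ≥ 0`). Then `F` is
radial: `F(r cos φ, r sin φ) = F(r, 0)` for all `r > 0` and all `φ`.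

Proof (pure glue over three sibling theorems of this line). Write `L(u,v) = ((u+v)/√2, (u-v)/√2)`,
an involution of `ℝ²`, and `Φ = F ∘ L` (the light-cone transform); `Φ` is again continuous off `0`
and `D₄`-symmetric, the diagonal representations of `F` are literally axis representations of `Φ`,
and (through `L ∘ L = id`) the axis representations of `F` are diagonal representations of `Φ`.
* The cone for the axis measures `μ_ε`: `stub_planarDiscSections` (fed by the diagonal
  representations) continues `b ↦ F(ε + t, b) = ∫ e^{-t p₀ + i b p₁} dμ_ε` to a bounded holomorphic
  function on the disc `|b| < t`, uniformly in `t`, and `stub_coneOfDiscSections`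
  (Lukacs / Landau–Pringsheim) turns these disc sections into `μ_ε {p₀ < |p₁|} = 0`
  (`PlanarRadial.axisCone`).
* The cone for the diagonal measures `μ^D_ε`: the same argument for `Φ`, whose roles of "axis" and
  "diagonal" are swapped.
* With both families carried by the light cone, `stub_planarAngularRigidity` (angular rigidity
  below the planar threshold `σ < 8`) gives radiality.

No definitions: `L` and `Φ` are written out. References: the three sibling files
`PencilRigidityShellRigidityPlanarDiscSections`, `…ConeOfDiscSections`, `…PlanarAngularRigidity`
(this line); E. Lukacs, *Characteristic functions* (2nd ed. 1970), Thm. 7.1.1, behind the second.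
-/

noncomputable section

namespace Summit.QuantumFields.YangMills.Cruxes.ShellRigidity.TransverseSmearingPlanarThreshold

open MeasureTheory Complex


/-! ## Helpers

They live in the sub-namespace `PlanarRadial` (no collisions with sibling stub files). -/

namespace PlanarRadial

/-- `L x ≠ 0` for `x ≠ 0`. -/
theorem lc_ne_zero {x : ℝ × ℝ} (hx : x ≠ 0) :
    ((x.1 + x.2) / Real.sqrt 2, (x.1 - x.2) / Real.sqrt 2) ≠ (0 : ℝ × ℝ) := by
  have hs0 : Real.sqrt 2 ≠ 0 := (Real.sqrt_pos.2 two_pos).ne'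
  intro hzero
  apply hx
  have h1 : (x.1 + x.2) / Real.sqrt 2 = 0 := congrArg Prod.fst hzero
  have h2 : (x.1 - x.2) / Real.sqrt 2 = 0 := congrArg Prod.snd hzero
  rw [div_eq_zero_iff] at h1 h2
  have h1' : x.1 + x.2 = 0 := h1.resolve_right hs0
  have h2' : x.1 - x.2 = 0 := h2.resolve_right hs0
  exact Prod.ext (by show x.1 = 0; linarith) (by show x.2 = 0; linarith)

/-- The light-cone transform `Φ = F ∘ L` of a kernel continuous off `0` is continuous off `0`. -/
theorem continuousOn_lc {F : ℝ × ℝ → ℝ} (hc : ContinuousOn F {x | x ≠ 0}) :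
    ContinuousOn (fun x : ℝ × ℝ => F ((x.1 + x.2) / Real.sqrt 2, (x.1 - x.2) / Real.sqrt 2))
      {x : ℝ × ℝ | x ≠ 0} := by
  have hLc : Continuous fun x : ℝ × ℝ =>
      ((x.1 + x.2) / Real.sqrt 2, (x.1 - x.2) / Real.sqrt 2) := by
    fun_prop
  exact hc.comp hLc.continuousOn fun x hx => lc_ne_zero hx

/-- The light-cone transform `Φ = F ∘ L` of a `D₄`-symmetric kernel is `D₄`-symmetric (`L`
normalises `D₄`: the swap becomes `x₁ ↦ -x₁`, `x₁ ↦ -x₁` becomes the swap, and `x₀ ↦ -x₀` becomes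
`(x₀, x₁) ↦ (-x₁, -x₀)`). -/
theorem symm_lc {F : ℝ × ℝ → ℝ}
    (hsym : ∀ t s : ℝ, F (t, s) = F (s, t) ∧ F (t, s) = F (t, -s) ∧ F (t, s) = F (-t, s)) :
    ∀ t s : ℝ,
      F ((t + s) / Real.sqrt 2, (t - s) / Real.sqrt 2) =
          F ((s + t) / Real.sqrt 2, (s - t) / Real.sqrt 2) ∧
        F ((t + s) / Real.sqrt 2, (t - s) / Real.sqrt 2) =
          F ((t + -s) / Real.sqrt 2, (t - -s) / Real.sqrt 2) ∧
        F ((t + s) / Real.sqrt 2, (t - s) / Real.sqrt 2) =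
          F ((-t + s) / Real.sqrt 2, (-t - s) / Real.sqrt 2) := by
  have hswap : ∀ a b : ℝ, F (a, b) = F (b, a) := fun a b => (hsym a b).1
  have hnegs : ∀ a b : ℝ, F (a, b) = F (a, -b) := fun a b => (hsym a b).2.1
  have hnegt : ∀ a b : ℝ, F (a, b) = F (-a, b) := fun a b => (hsym a b).2.2
  intro t s
  refine ⟨?_, ?_, ?_⟩
  · rw [hnegs ((s + t) / Real.sqrt 2), add_comm s t, ← neg_div, neg_sub]
  · rw [hswap ((t + -s) / Real.sqrt 2), ← sub_eq_add_neg, sub_neg_eq_add]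
  · rw [hnegt ((-t + s) / Real.sqrt 2), hnegs (-((-t + s) / Real.sqrt 2)),
      hswap (-((-t + s) / Real.sqrt 2))]
    congr 1
    refine Prod.ext ?_ ?_ <;> (field_simp; ring)

/-- **The cone for the axis measures.** If `F` (continuous off `0`, `D₄`) has axis representations
`F(ε + t, b) = ∫ e^{-t p₀ + i b p₁} dμ_ε` and diagonal representations for every `ε > 0`, then every
axis family may be taken carried by the light cone `{p₀ ≥ |p₁|}` (indeed the given `μ_ε` are):
`stub_planarDiscSections` (fed by the diagonal representations) makes `b ↦ F(ε + t, b)` a bounded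
disc section on `|b| < t`, uniformly in `t > 0`, and `stub_coneOfDiscSections` concludes. -/
theorem axisCone (F : ℝ × ℝ → ℝ) (hc : ContinuousOn F {x | x ≠ 0})
    (hsym : ∀ t s : ℝ, F (t, s) = F (s, t) ∧ F (t, s) = F (t, -s) ∧ F (t, s) = F (-t, s))
    (hA : ∀ ε : ℝ, 0 < ε → ∃ μ : Measure (EuclideanSpace ℝ (Fin 4)), IsFiniteMeasure μ ∧
      μ {p | p 0 < 0} = 0 ∧
      ∀ t : ℝ, 0 ≤ t → ∀ b : ℝ, ((F (ε + t, b) : ℝ) : ℂ) =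
        ∫ p, cexp ((((-(t * p 0) : ℝ)) : ℂ) + ((b * p 1 : ℝ) : ℂ) * I) ∂μ)
    (hD : ∀ ε : ℝ, 0 < ε → ∃ μ : Measure (EuclideanSpace ℝ (Fin 4)), IsFiniteMeasure μ ∧
      μ {p | p 0 < 0} = 0 ∧
      ∀ u : ℝ, 0 ≤ u → ∀ v : ℝ,
        ((F ((ε + u + v) / Real.sqrt 2, (ε + u - v) / Real.sqrt 2) : ℝ) : ℂ) =
          ∫ p, cexp ((((-(u * p 0) : ℝ)) : ℂ) + ((v * p 1 : ℝ) : ℂ) * I) ∂μ) :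
    ∀ ε : ℝ, 0 < ε → ∃ μ : Measure (EuclideanSpace ℝ (Fin 4)), IsFiniteMeasure μ ∧
      μ {p | p 0 < 0} = 0 ∧ μ {p | p 0 < |p 1|} = 0 ∧
      ∀ t : ℝ, 0 ≤ t → ∀ b : ℝ, ((F (ε + t, b) : ℝ) : ℂ) =
        ∫ p, cexp ((((-(t * p 0) : ℝ)) : ℂ) + ((b * p 1 : ℝ) : ℂ) * I) ∂μ := by
  intro ε hε
  obtain ⟨μ, hfin, hE, hrep⟩ := hA ε hε
  obtain ⟨M, hM⟩ := stub_planarDiscSections F hc hsym hD ε hε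
  haveI := hfin
  refine ⟨μ, hfin, hE, stub_coneOfDiscSections μ hE M (fun t ht => ?_), hrep⟩
  obtain ⟨f, hfd, hfb, hfr⟩ := hM t ht
  exact ⟨f, hfd, hfb, fun b hbt => (hfr b hbt).trans (hrep t ht.le b)⟩

end PlanarRadial

/-! ## The stub -/

/-- **Stub · the planar engine** (S; glue, registered so that it lands as its own file): a planar
kernel (continuous off `0`, order `0 < σ < 8`, `D₄`) with axis Laplace–Fourier representations of
`F(ε + t, b)` and of the diagonal restriction `F((ε+u+v)/√2, (ε+u-v)/√2)` for every `ε > 0` is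
radial — `stub_planarDiscSections` for `F` (fed by the diagonal representations) and for its
light-cone transform `Φ = F ∘ L` (fed by the axis ones, `L (u,v) = ((u+v)/√2, (u-v)/√2)` an
involution), `stub_coneOfDiscSections` for every measure (`PlanarRadial.axisCone`), then
`stub_planarAngularRigidity`. -/
theorem stub_planarRadial (F : ℝ × ℝ → ℝ) (σ : ℝ) (hσ : 0 < σ) (hσ8 : σ < 8)
    (hc : ContinuousOn F {x | x ≠ 0})
    (hb : ∃ C : ℝ, ∀ x : ℝ × ℝ, x ≠ 0 → |F x| ≤ C * (1 + (x.1 ^ 2 + x.2 ^ 2) ^ (-(σ / 2))))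
    (hsym : ∀ t s : ℝ, F (t, s) = F (s, t) ∧ F (t, s) = F (t, -s) ∧ F (t, s) = F (-t, s))
    (hA : ∀ ε : ℝ, 0 < ε → ∃ μ : Measure (EuclideanSpace ℝ (Fin 4)), IsFiniteMeasure μ ∧
      μ {p | p 0 < 0} = 0 ∧
      ∀ t : ℝ, 0 ≤ t → ∀ b : ℝ, ((F (ε + t, b) : ℝ) : ℂ) =
        ∫ p, cexp ((((-(t * p 0) : ℝ)) : ℂ) + ((b * p 1 : ℝ) : ℂ) * I) ∂μ)
    (hD : ∀ ε : ℝ, 0 < ε → ∃ μ : Measure (EuclideanSpace ℝ (Fin 4)), IsFiniteMeasure μ ∧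
      μ {p | p 0 < 0} = 0 ∧
      ∀ u : ℝ, 0 ≤ u → ∀ v : ℝ, ((F ((ε + u + v) / Real.sqrt 2, (ε + u - v) / Real.sqrt 2) : ℝ) : ℂ) =
        ∫ p, cexp ((((-(u * p 0) : ℝ)) : ℂ) + ((v * p 1 : ℝ) : ℂ) * I) ∂μ) :
    ∀ r φ : ℝ, 0 < r → F (r * Real.cos φ, r * Real.sin φ) = F (r, 0) := by
  -- the cone for the axis measures of `F`
  have hAcone := PlanarRadial.axisCone F hc hsym hA hD
  -- the light-cone transform `Φ = F ∘ L` is continuous off `0` and `D₄`-symmetric; its axis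
  -- representations are the diagonal representations of `F` (definitionally), and its diagonal
  -- representations are the axis representations of `F` (`L ∘ L = id`)
  have hDΦ : ∀ ε : ℝ, 0 < ε → ∃ μ : Measure (EuclideanSpace ℝ (Fin 4)), IsFiniteMeasure μ ∧
      μ {p | p 0 < 0} = 0 ∧
      ∀ u : ℝ, 0 ≤ u → ∀ v : ℝ,
        (((fun x : ℝ × ℝ => F ((x.1 + x.2) / Real.sqrt 2, (x.1 - x.2) / Real.sqrt 2))
            ((ε + u + v) / Real.sqrt 2, (ε + u - v) / Real.sqrt 2) : ℝ) : ℂ) =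
          ∫ p, cexp ((((-(u * p 0) : ℝ)) : ℂ) + ((v * p 1 : ℝ) : ℂ) * I) ∂μ := by
    intro ε hε
    obtain ⟨μ, hfin, hE, hrep⟩ := hA ε hε
    refine ⟨μ, hfin, hE, fun u hu v => ?_⟩
    simpa only [Summit.QuantumFields.YangMills.Cruxes.PlanarSpectralCone.TwoMirrorLightconeSlots.DiscSections.lightCone_real_sum,
      Summit.QuantumFields.YangMills.Cruxes.PlanarSpectralCone.TwoMirrorLightconeSlots.DiscSections.lightCone_real_sub] using
      hrep u hu v
  -- the cone for the diagonal measures of `F` = the axis measures of `Φ`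
  have hDcone := PlanarRadial.axisCone
    (fun x : ℝ × ℝ => F ((x.1 + x.2) / Real.sqrt 2, (x.1 - x.2) / Real.sqrt 2))
    (PlanarRadial.continuousOn_lc hc) (PlanarRadial.symm_lc hsym) hD hDΦ
  -- angular rigidity below the planar threshold
  exact stub_planarAngularRigidity F σ hσ hσ8 hc hb hsym hAcone hDcone

end Summit.QuantumFields.YangMills.Cruxes.ShellRigidity.TransverseSmearingPlanarThreshold

end
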